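import Mathlib
import Summits.MatrixMultiplication.Statement
import Summits.MatrixMultiplication.MatrixMultiplication.Theorems.GraphEquationsNullExpLadder
import Summits.MatrixMultiplication.MatrixMultiplication.Theorems.GraphEquationsNullExpMembers

/-!
# Graph equations — THE LOCAL MEMBERSHIP EXPONENT: THE MIDDLE CURRENCY (M19h)

Between the isolation order `K` (K-ladder BOP′, hand OR′) and the global membership exponent `e`
(e-ladder NEP, hand NER) sits the LOCAL membership exponent at a base `y`: the least `e` with
`ι(g_q)·f_q^e ∈ J_E` for multipliers `g_q ∈ ℂ[A,B]` that are UNITS at `y` (`g_q(y) ≠ 0`).  All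
statements are spelled out over existing declarations (no definition):

  LOCMEM β e : cost-`n^β` families of CORRECT systems with, at SOME base `y`, `ι(g_q)·f_q^e ∈ J_E`,
               `g_q(y) ≠ 0`, for every position `q`;
  NER_loc    : `∀ β ≥ 2, EqAdmissible β → ∀ β' > β, ∃ e ≥ 1, LOCMEM β' e`;
  NEP_loc e  : `∀ β ≥ 2, LOCMEM β e → ∀ β' > β, EqAdmissibleRed β'`.

* `EqSystem.idealInitIsolatedAt_of_local_generator_pow_mem` — local membership exponent `e` at `y`
  ⇒ ideal isolation of order `e` at `y` (members `ι(g_q) f_q^e`, forms `g_q(y)·F_q^e`, diagonal);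
  `eqAdmissibleIdealIso_of_local_generator_pow_mem` — LOCMEM β e ⇒ `EqAdmissibleIdealIso β e`.
* THE SANDWICH, all kernel-checked:  hands `NER ⇒ NER_loc ⇒ OR′`
  (`localNullExpReduction_of_nullExpReduction`, `isolationOrderReduction_of_localNullExpReduction`;
  NER_loc is NECESSARY: `localNullExpReduction_of_matrixMultiplication`), rungs
  `BOP′_e ⇒ NEP_loc e ⇒ NEP_e` (`localNullExpPurification_of_boundedOrderPurification`,
  `nullExpPurification_of_localNullExpPurification`), every local rung necessary for the crux
  (`localNullExpPurification_of_multiplicityReduction`), local rungs `e ≤ 2` THEOREMS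
  (`localNullExpPurification_two`, `localNullExpPurification_one`).
* `multiplicityReduction_of_localNullExpReduction_of_localNullExpPurification` (+ `_of_rungs_ge_three`)
  — THE BRIDGE in the middle currency.
* `iterate_derivC_liftAB_mul_generator_pow_pred` — the e-engine runs on LOCAL members unchanged:
  `e-1` deflation steps send `ι(g)·f_q^e` to `e!·ι(g·∏ μ_i(q))·f_q` EXACTLY (M19f + `ℂ[A,B]`-linearity).

By `GraphEquationsIsoVsExp` even the local exponent is not bounded by the isolation order
(`(Σ ±ℓ_i)^{n²} ≠ 0` holds over the residue field of every base), so `NER_loc` is still a strictly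
stronger family property than OR′; it is the weakest currency in which the finite range is
diagonal (residual-free blueprint, NODE-g32 rev 3–5).
-/

set_option linter.dupNamespace false

noncomputable section

open scoped BigOperators

namespace Summit.MatrixMultiplication.MatrixMultiplication.Theorems.GraphEquations

open MvPolynomial
open Literature.Computability.AlgebraicComplexity

variable {n : ℕ}

/-! ## Local membership ⇒ ideal isolation at that base -/

namespace EqSystem

/-- **Local membership exponent `e` at `y` ⇒ ideal isolation of order `e` at `y`.** -/
theorem idealInitIsolatedAt_of_local_generator_pow_mem (E : EqSystem n) {e : ℕ} (he : 1 ≤ e)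
    (y : MatMulVars n → ℂ)
    (h : ∀ q : Fin n × Fin n, ∃ g : MvPolynomial (MatMulVars n) ℂ, eval y g ≠ 0 ∧
      liftAB n g * generator n q ^ e ∈
        Ideal.span (Set.range fun o : Fin E.tests.length => E.testPoly (E.tests.get o))) :
    E.IdealInitIsolatedAt e y := by
  classical
  choose g hg hmem using h
  let ε : Fin (Fintype.card (Fin n × Fin n)) ≃ Fin n × Fin n := (Fintype.equivFin (Fin n × Fin n)).symm
  have hhom : ∀ q : Fin n × Fin n, (C (g q) * X q ^ e : FPoly n).IsHomogeneous e := fun q => by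
    simpa using (isHomogeneous_C (Fin n × Fin n) (g q)).mul (isHomogeneous_X_pow q e)
  refine ⟨Fintype.card (Fin n × Fin n), fun i => liftAB n (g (ε i)) * generator n (ε i) ^ e,
    fun i => hmem _, ?_⟩
  refine ⟨fun _ => e, fun i => C (g (ε i)) * X (ε i) ^ e, fun _ => le_rfl, fun i => ?_, fun i j hj => ?_,
    fun F₀ hF => ?_⟩
  · rw [map_mul, map_pow, substF_C, substF_X]
  · have hj' : j < e := hj
    rw [homogeneousComponent_of_mem ((mem_homogeneousSubmodule _ _).mpr (hhom (ε i))), if_neg (by omega)]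
  · funext q
    have hq := hF (ε.symm q)
    simp only [Equiv.apply_symm_apply,
      homogeneousComponent_of_mem ((mem_homogeneousSubmodule _ _).mpr (hhom q)), if_true, map_mul, map_pow,
      map_C, map_X, eval_C, eval_X, Pi.zero_apply, zero_pow (by omega : e ≠ 0), mul_zero, mul_eq_zero] at hq
    rcases hq with hq | hq
    · exact absurd hq (hg q)
    · exact eq_zero_of_pow_eq_zero hq

end EqSystem

/-- **LOCMEM β e ⇒ `EqAdmissibleIdealIso β e`** (`1 ≤ e`). -/
theorem eqAdmissibleIdealIso_of_local_generator_pow_mem {β : ℝ} {e : ℕ} (he : 1 ≤ e)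
    (h : ∃ c : ℝ, ∀ n : ℕ, 1 ≤ n → ∃ E : EqSystem n, E.Correct ∧
      (∃ y : MatMulVars n → ℂ, ∀ q : Fin n × Fin n, ∃ g : MvPolynomial (MatMulVars n) ℂ, eval y g ≠ 0 ∧
        liftAB n g * generator n q ^ e ∈
          Ideal.span (Set.range fun o : Fin E.tests.length => E.testPoly (E.tests.get o))) ∧
      (E.cost : ℝ) ≤ c * (n : ℝ) ^ β) :
    EqAdmissibleIdealIso β e := by
  obtain ⟨c, hc⟩ := h
  refine ⟨c, fun n hn => ?_⟩
  obtain ⟨E, hE, ⟨y, hy⟩, hcost⟩ := hc n hn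
  exact ⟨E, hE, ⟨y, E.idealInitIsolatedAt_of_local_generator_pow_mem he y hy⟩, hcost⟩

/-- Global membership is local membership with the multiplier `1`. -/
theorem local_of_generator_pow_mem {E : EqSystem n} {e : ℕ}
    (h : ∀ q : Fin n × Fin n, generator n q ^ e ∈
      Ideal.span (Set.range fun o : Fin E.tests.length => E.testPoly (E.tests.get o)))
    (y : MatMulVars n → ℂ) :
    ∀ q : Fin n × Fin n, ∃ g : MvPolynomial (MatMulVars n) ℂ, eval y g ≠ 0 ∧
      liftAB n g * generator n q ^ e ∈
        Ideal.span (Set.range fun o : Fin E.tests.length => E.testPoly (E.tests.get o)) :=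
  fun q => ⟨1, by simp, by simpa using h q⟩

/-! ## The hands: NER ⇒ NER_loc ⇒ OR′; NER_loc is necessary -/

/-- **NER ⇒ NER_loc.** -/
theorem localNullExpReduction_of_nullExpReduction
    (hNER : ∀ β : ℝ, 2 ≤ β → EqAdmissible β → ∀ β' : ℝ, β < β' →
      ∃ e : ℕ, 1 ≤ e ∧ ∃ c : ℝ, ∀ n : ℕ, 1 ≤ n → ∃ E : EqSystem n, E.Correct ∧
        (∀ q : Fin n × Fin n, generator n q ^ e ∈
          Ideal.span (Set.range fun o : Fin E.tests.length => E.testPoly (E.tests.get o))) ∧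
        (E.cost : ℝ) ≤ c * (n : ℝ) ^ β') :
    ∀ β : ℝ, 2 ≤ β → EqAdmissible β → ∀ β' : ℝ, β < β' →
      ∃ e : ℕ, 1 ≤ e ∧ ∃ c : ℝ, ∀ n : ℕ, 1 ≤ n → ∃ E : EqSystem n, E.Correct ∧
        (∃ y : MatMulVars n → ℂ, ∀ q : Fin n × Fin n, ∃ g : MvPolynomial (MatMulVars n) ℂ, eval y g ≠ 0 ∧
          liftAB n g * generator n q ^ e ∈
            Ideal.span (Set.range fun o : Fin E.tests.length => E.testPoly (E.tests.get o))) ∧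
        (E.cost : ℝ) ≤ c * (n : ℝ) ^ β' := by
  intro β hβ hA β' hβ'
  obtain ⟨e, he, c, hc⟩ := hNER β hβ hA β' hβ'
  refine ⟨e, he, c, fun n hn => ?_⟩
  obtain ⟨E, hE, hmem, hcost⟩ := hc n hn
  exact ⟨E, hE, ⟨0, local_of_generator_pow_mem hmem 0⟩, hcost⟩

/-- **NER_loc is NECESSARY** (`e = 1`, multipliers `1`, generator systems). -/
theorem localNullExpReduction_of_matrixMultiplication (hS : _root_.MatrixMultiplication) :
    ∀ β : ℝ, 2 ≤ β → EqAdmissible β → ∀ β' : ℝ, β < β' →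
      ∃ e : ℕ, 1 ≤ e ∧ ∃ c : ℝ, ∀ n : ℕ, 1 ≤ n → ∃ E : EqSystem n, E.Correct ∧
        (∃ y : MatMulVars n → ℂ, ∀ q : Fin n × Fin n, ∃ g : MvPolynomial (MatMulVars n) ℂ, eval y g ≠ 0 ∧
          liftAB n g * generator n q ^ e ∈
            Ideal.span (Set.range fun o : Fin E.tests.length => E.testPoly (E.tests.get o))) ∧
        (E.cost : ℝ) ≤ c * (n : ℝ) ^ β' :=
  localNullExpReduction_of_nullExpReduction (nullExpReduction_of_matrixMultiplication hS)

/-- **NER_loc ⇒ OR′.** -/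
theorem isolationOrderReduction_of_localNullExpReduction
    (hL : ∀ β : ℝ, 2 ≤ β → EqAdmissible β → ∀ β' : ℝ, β < β' →
      ∃ e : ℕ, 1 ≤ e ∧ ∃ c : ℝ, ∀ n : ℕ, 1 ≤ n → ∃ E : EqSystem n, E.Correct ∧
        (∃ y : MatMulVars n → ℂ, ∀ q : Fin n × Fin n, ∃ g : MvPolynomial (MatMulVars n) ℂ, eval y g ≠ 0 ∧
          liftAB n g * generator n q ^ e ∈
            Ideal.span (Set.range fun o : Fin E.tests.length => E.testPoly (E.tests.get o))) ∧
        (E.cost : ℝ) ≤ c * (n : ℝ) ^ β') :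
    ∀ β : ℝ, 2 ≤ β → EqAdmissible β → ∀ β' : ℝ, β < β' → ∃ K : ℕ, EqAdmissibleIdealIso β' K := by
  intro β hβ hA β' hβ'
  obtain ⟨e, he, h⟩ := hL β hβ hA β' hβ'
  exact ⟨e, eqAdmissibleIdealIso_of_local_generator_pow_mem he h⟩

/-! ## The rungs: BOP′_e ⇒ NEP_loc e ⇒ NEP_e; every local rung is necessary; `e ≤ 2` proved -/

/-- **BOP′_e ⇒ NEP_loc e** (`1 ≤ e`). -/
theorem localNullExpPurification_of_boundedOrderPurification {e : ℕ} (he : 1 ≤ e)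
    (hBOP : ∀ β : ℝ, 2 ≤ β → EqAdmissibleIdealIso β e → ∀ β' : ℝ, β < β' → EqAdmissiblePure β') :
    ∀ β : ℝ, 2 ≤ β →
      (∃ c : ℝ, ∀ n : ℕ, 1 ≤ n → ∃ E : EqSystem n, E.Correct ∧
        (∃ y : MatMulVars n → ℂ, ∀ q : Fin n × Fin n, ∃ g : MvPolynomial (MatMulVars n) ℂ, eval y g ≠ 0 ∧
          liftAB n g * generator n q ^ e ∈
            Ideal.span (Set.range fun o : Fin E.tests.length => E.testPoly (E.tests.get o))) ∧
        (E.cost : ℝ) ≤ c * (n : ℝ) ^ β) →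
      ∀ β' : ℝ, β < β' → EqAdmissibleRed β' := by
  intro β hβ h β' hβ'
  have hpure : EqAdmissiblePure ((β + β') / 2) :=
    hBOP β hβ (eqAdmissibleIdealIso_of_local_generator_pow_mem he h) _ (by linarith)
  exact eqAdmissibleRed_of_omega_lt (hpure.omega_le.trans_lt (by linarith))

/-- **NEP_loc e ⇒ NEP_e.** -/
theorem nullExpPurification_of_localNullExpPurification {e : ℕ}
    (hL : ∀ β : ℝ, 2 ≤ β →
      (∃ c : ℝ, ∀ n : ℕ, 1 ≤ n → ∃ E : EqSystem n, E.Correct ∧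
        (∃ y : MatMulVars n → ℂ, ∀ q : Fin n × Fin n, ∃ g : MvPolynomial (MatMulVars n) ℂ, eval y g ≠ 0 ∧
          liftAB n g * generator n q ^ e ∈
            Ideal.span (Set.range fun o : Fin E.tests.length => E.testPoly (E.tests.get o))) ∧
        (E.cost : ℝ) ≤ c * (n : ℝ) ^ β) →
      ∀ β' : ℝ, β < β' → EqAdmissibleRed β') :
    ∀ β : ℝ, 2 ≤ β →
      (∃ c : ℝ, ∀ n : ℕ, 1 ≤ n → ∃ E : EqSystem n, E.Correct ∧
        (∀ q : Fin n × Fin n, generator n q ^ e ∈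
          Ideal.span (Set.range fun o : Fin E.tests.length => E.testPoly (E.tests.get o))) ∧
        (E.cost : ℝ) ≤ c * (n : ℝ) ^ β) →
      ∀ β' : ℝ, β < β' → EqAdmissibleRed β' := by
  intro β hβ h β' hβ'
  obtain ⟨c, hc⟩ := h
  refine hL β hβ ⟨c, fun n hn => ?_⟩ β' hβ'
  obtain ⟨E, hE, hmem, hcost⟩ := hc n hn
  exact ⟨E, hE, ⟨0, local_of_generator_pow_mem hmem 0⟩, hcost⟩

/-- **Every local rung is necessary**: `MultiplicityReduction ⇒ NEP_loc e` for every `e`. -/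
theorem localNullExpPurification_of_multiplicityReduction (hMR : MultiplicityReduction) (e : ℕ) :
    ∀ β : ℝ, 2 ≤ β →
      (∃ c : ℝ, ∀ n : ℕ, 1 ≤ n → ∃ E : EqSystem n, E.Correct ∧
        (∃ y : MatMulVars n → ℂ, ∀ q : Fin n × Fin n, ∃ g : MvPolynomial (MatMulVars n) ℂ, eval y g ≠ 0 ∧
          liftAB n g * generator n q ^ e ∈
            Ideal.span (Set.range fun o : Fin E.tests.length => E.testPoly (E.tests.get o))) ∧
        (E.cost : ℝ) ≤ c * (n : ℝ) ^ β) →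
      ∀ β' : ℝ, β < β' → EqAdmissibleRed β' := by
  intro β hβ h β' hβ'
  obtain ⟨c, hc⟩ := h
  exact hMR β hβ ⟨c, fun n hn => by obtain ⟨E, hE, -, hcost⟩ := hc n hn; exact ⟨E, hE, hcost⟩⟩ β' hβ'

/-- **Local rung `e = 2` is a theorem** (rung `K = 2` of BOP′, `boundedOrderPurification_two`). -/
theorem localNullExpPurification_two :
    ∀ β : ℝ, 2 ≤ β →
      (∃ c : ℝ, ∀ n : ℕ, 1 ≤ n → ∃ E : EqSystem n, E.Correct ∧
        (∃ y : MatMulVars n → ℂ, ∀ q : Fin n × Fin n, ∃ g : MvPolynomial (MatMulVars n) ℂ, eval y g ≠ 0 ∧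
          liftAB n g * generator n q ^ 2 ∈
            Ideal.span (Set.range fun o : Fin E.tests.length => E.testPoly (E.tests.get o))) ∧
        (E.cost : ℝ) ≤ c * (n : ℝ) ^ β) →
      ∀ β' : ℝ, β < β' → EqAdmissibleRed β' :=
  localNullExpPurification_of_boundedOrderPurification (by norm_num) boundedOrderPurification_two

/-- **Local rung `e = 1` is a theorem** (`ι(g) f_q ∈ J_E ⇒ ι(g) f_q² ∈ J_E`). -/
theorem localNullExpPurification_one :
    ∀ β : ℝ, 2 ≤ β →
      (∃ c : ℝ, ∀ n : ℕ, 1 ≤ n → ∃ E : EqSystem n, E.Correct ∧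
        (∃ y : MatMulVars n → ℂ, ∀ q : Fin n × Fin n, ∃ g : MvPolynomial (MatMulVars n) ℂ, eval y g ≠ 0 ∧
          liftAB n g * generator n q ^ 1 ∈
            Ideal.span (Set.range fun o : Fin E.tests.length => E.testPoly (E.tests.get o))) ∧
        (E.cost : ℝ) ≤ c * (n : ℝ) ^ β) →
      ∀ β' : ℝ, β < β' → EqAdmissibleRed β' := by
  intro β hβ h β' hβ'
  obtain ⟨c, hc⟩ := h
  refine localNullExpPurification_two β hβ ⟨c, fun n hn => ?_⟩ β' hβ'
  obtain ⟨E, hE, ⟨y, hy⟩, hcost⟩ := hc n hn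
  refine ⟨E, hE, ⟨y, fun q => ?_⟩, hcost⟩
  obtain ⟨g, hg, hmem⟩ := hy q
  refine ⟨g, hg, ?_⟩
  rw [pow_two, ← mul_assoc]
  exact Ideal.mul_mem_right _ _ (by simpa only [pow_one] using hmem)

/-! ## The bridge in the middle currency -/

/-- **THE BRIDGE: NER_loc ∧ (∀ e ≥ 1, NEP_loc e) ⇒ `MultiplicityReduction`.** -/
theorem multiplicityReduction_of_localNullExpReduction_of_localNullExpPurification
    (hL : ∀ β : ℝ, 2 ≤ β → EqAdmissible β → ∀ β' : ℝ, β < β' →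
      ∃ e : ℕ, 1 ≤ e ∧ ∃ c : ℝ, ∀ n : ℕ, 1 ≤ n → ∃ E : EqSystem n, E.Correct ∧
        (∃ y : MatMulVars n → ℂ, ∀ q : Fin n × Fin n, ∃ g : MvPolynomial (MatMulVars n) ℂ, eval y g ≠ 0 ∧
          liftAB n g * generator n q ^ e ∈
            Ideal.span (Set.range fun o : Fin E.tests.length => E.testPoly (E.tests.get o))) ∧
        (E.cost : ℝ) ≤ c * (n : ℝ) ^ β')
    (hP : ∀ e : ℕ, 1 ≤ e → ∀ β : ℝ, 2 ≤ β →
      (∃ c : ℝ, ∀ n : ℕ, 1 ≤ n → ∃ E : EqSystem n, E.Correct ∧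
        (∃ y : MatMulVars n → ℂ, ∀ q : Fin n × Fin n, ∃ g : MvPolynomial (MatMulVars n) ℂ, eval y g ≠ 0 ∧
          liftAB n g * generator n q ^ e ∈
            Ideal.span (Set.range fun o : Fin E.tests.length => E.testPoly (E.tests.get o))) ∧
        (E.cost : ℝ) ≤ c * (n : ℝ) ^ β) →
      ∀ β' : ℝ, β < β' → EqAdmissibleRed β') :
    MultiplicityReduction := by
  intro β hβ hA β' hβ'
  obtain ⟨e, he, c, hc⟩ := hL β hβ hA ((β + β') / 2) (by linarith)
  exact hP e he ((β + β') / 2) (by linarith) ⟨c, hc⟩ β' (by linarith)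

/-- **Given NER_loc, the crux follows from the local rungs `e ≥ 3` alone.** -/
theorem multiplicityReduction_of_localNullExpReduction_of_rungs_ge_three
    (hL : ∀ β : ℝ, 2 ≤ β → EqAdmissible β → ∀ β' : ℝ, β < β' →
      ∃ e : ℕ, 1 ≤ e ∧ ∃ c : ℝ, ∀ n : ℕ, 1 ≤ n → ∃ E : EqSystem n, E.Correct ∧
        (∃ y : MatMulVars n → ℂ, ∀ q : Fin n × Fin n, ∃ g : MvPolynomial (MatMulVars n) ℂ, eval y g ≠ 0 ∧
          liftAB n g * generator n q ^ e ∈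
            Ideal.span (Set.range fun o : Fin E.tests.length => E.testPoly (E.tests.get o))) ∧
        (E.cost : ℝ) ≤ c * (n : ℝ) ^ β')
    (hP : ∀ e : ℕ, 3 ≤ e → ∀ β : ℝ, 2 ≤ β →
      (∃ c : ℝ, ∀ n : ℕ, 1 ≤ n → ∃ E : EqSystem n, E.Correct ∧
        (∃ y : MatMulVars n → ℂ, ∀ q : Fin n × Fin n, ∃ g : MvPolynomial (MatMulVars n) ℂ, eval y g ≠ 0 ∧
          liftAB n g * generator n q ^ e ∈
            Ideal.span (Set.range fun o : Fin E.tests.length => E.testPoly (E.tests.get o))) ∧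
        (E.cost : ℝ) ≤ c * (n : ℝ) ^ β) →
      ∀ β' : ℝ, β < β' → EqAdmissibleRed β') :
    MultiplicityReduction := by
  refine multiplicityReduction_of_localNullExpReduction_of_localNullExpPurification hL fun e he => ?_
  rcases Nat.lt_or_ge e 3 with h3 | h3
  · interval_cases e
    · exact localNullExpPurification_one
    · exact localNullExpPurification_two
  · exact hP e h3

/-! ## The e-engine on local members -/

/-- **`e-1` steps on a LOCAL member**: `D_{μ₁}(⋯D_{μ_L}(ι(g)·f_q^{L+1})) = (L+1)!·ι(g·∏ μ_i(q))·f_q`. -/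
theorem iterate_derivC_liftAB_mul_generator_pow_pred (q : Fin n × Fin n)
    (g : MvPolynomial (MatMulVars n) ℂ) (μs : List (Fin n × Fin n → MvPolynomial (MatMulVars n) ℂ)) :
    μs.foldr (fun μ v => derivC μ v) (liftAB n g * generator n q ^ (μs.length + 1)) =
      C ((Nat.factorial (μs.length + 1) : ℕ) : ℂ) * liftAB n (g * (μs.map fun μ => μ q).prod) *
        generator n q := by
  have key : ∀ (νs : List (Fin n × Fin n → MvPolynomial (MatMulVars n) ℂ)) (u : MvPolynomial (GraphVars n) ℂ),
      νs.foldr (fun μ v => derivC μ v) (liftAB n g * u) = liftAB n g * νs.foldr (fun μ v => derivC μ v) u := by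
    intro νs u
    induction νs with
    | nil => rfl
    | cons ν νs ih => rw [List.foldr_cons, List.foldr_cons, ih, derivC_liftAB_mul]
  rw [key, iterate_derivC_generator_pow_pred, map_mul]
  ring

end Summit.MatrixMultiplication.MatrixMultiplication.Theorems.GraphEquations

end
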